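import Summits.ResolutionOfSingularities.ResolutionOfSingularities.Theorems.FrobeniusClosingPatchingRelPerfectConeDepthSmoothQuadricCharts
import HarnessLib

/-!
# Crux `PatchingRelPerfect` (stmt-ResolutionOfSingularities-16161), chain W5.2 — rung «r-smooth-cone-ℓ», local algebra: the
# CONE OVER A SMOOTH PLANE CURVE `N(c₁, c₂, c₃)` (any degree, arbitrary coefficients) on the charts of the blowing up of its vertex

[OURS · L1 W5.2 · rung tool] Replaces the role of NO printed item; NOT a statement of the manuscript under review; fact-free,
any characteristic, any residue field, any degree.  AI-written (AI review is weaker than expert review).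

`R` regular local with regular system of parameters `c₀, …, c₃`, `N ∈ R[U₀, U₁, U₂]` a form, host `N(c₁, c₂, c₃)` — the cone
over the plane curve `C = V(N̄) ⊂ ℙ²_κ` with vertex on the carrier `V(c₀)`; as a form in four variables `Q = N(T₁, T₂, T₃)`
(`MvPolynomial.rename Fin.succ N`).  HYPOTHESES on the reduced chart polynomials `F_i = Q̄|_{T_i = 1}` (`ConeDepth.chartPoly`):
(HV) on the vertex chart `i = 0`: `(T₁, T₂, T₃)^m ≤ (F₀, ∂F₀)` for some `m` (the affine cone over `C` is singular only at its
vertex); (HC) on a chart `i ≠ 0`: `(F_i, ∂F_i) = (1)` (`C` is smooth on the chart `U_{i-1} = 1`).  THEN: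
* `smoothConeChart_zero` — chart `0`, at a prime over `𝔪` OFF the vertex (not all of `e₁, e₂, e₃` in `𝔓`): the members of
  `{φ(c₀), f₀}` in `𝔓` are part of one regular system of parameters (under (HV));
* `smoothConeChart_ne_zero` — chart `i ≠ 0`: the members of `{φ(c_i), e₀, f_i}` in `𝔓` (exceptional divisor, old carrier, host)
  are part of one regular system of parameters (under (HC); `e₀` killed when it lies in `𝔓`, the representative of `f_i` not
  involving `T₀`);
* `algebraMap_chartForm_rename_succ` — at the vertex the host reads `N^ψ(v₁, v₂, v₃)` in the new regular system of parameters
  `v = (φ c₀, e₁, e₂, e₃)` of `coneVertex`: the cone reproduces itself one exceptional level up;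
* the distinctness lemmas `chartForm_rename_succ_ne_chartGen_zero`, `pderiv_zero_chartPoly_rename_succ`.
This generalises g4's `coneChart_zero` / `coneChart_linear` / `coneChart_three` (the quadric cone `T₁T₂ + T₃²`) to every cone over a
smooth plane curve: conic cones with anisotropic conic (odd residue characteristic), Fermat and elliptic cubic cones, ….

## References
* H. Matsumura, *Commutative Ring Theory*, CUP 1986, Thm. 14.2, Thm. 30.3. [Matsumura1987]
* The Stacks Project, Tags 0804, 0BIQ. [StacksProject]
* J. Kollár, *Lectures on Resolution of Singularities* (2007), Def. 3.24, 3.61. [Kollar2007]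
-/

set_option linter.dupNamespace false

noncomputable section

open CategoryTheory CategoryTheory.Limits AlgebraicGeometry TopologicalSpace IsLocalRing
open Literature.AlgebraicGeometry.Resolution
open Scheme.IdealSheafData
open scoped Pointwise

namespace Summit.ResolutionOfSingularities.ResolutionOfSingularities.Theorems

universe u

namespace ConeDepth

/-! ## Polynomial preliminaries -/

/-- A partial derivative in a variable outside the range of a renaming kills the renamed polynomial. [folklore] -/
theorem pderiv_rename_of_not_mem_range {σ τ : Type*} {K : Type*} [CommSemiring K] [DecidableEq τ] {f : σ → τ} {t : τ}
    (ht : t ∉ Set.range f) (p : MvPolynomial σ K) : MvPolynomial.pderiv t (MvPolynomial.rename f p) = 0 := by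
  classical
  induction p using MvPolynomial.induction_on with
  | C a => rw [MvPolynomial.rename_C, MvPolynomial.pderiv_C]
  | add p q hp hq => rw [map_add, map_add, hp, hq, add_zero]
  | mul_X p s hp =>
    have hs : f s ≠ t := fun h => ht ⟨s, h⟩
    rw [map_mul, MvPolynomial.rename_X, Derivation.leibniz, hp, smul_zero, add_zero, MvPolynomial.pderiv_X_of_ne hs, smul_zero]

/-- A local homomorphism from «the prime lies over the maximal ideal». [folklore] -/
theorem isLocalHom_of_comap_eq {R A L : Type*} [CommRing R] [IsLocalRing R] [CommRing A] [CommRing L] [IsLocalRing L]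
    (ψ : R →+* A) (𝔓 : Ideal A) [𝔓.IsPrime] (h𝔓 : 𝔓.comap ψ = maximalIdeal R) [Algebra A L] [IsLocalization.AtPrime L 𝔓] :
    IsLocalHom ((algebraMap A L).comp ψ) := by
  refine ⟨fun a ha => ?_⟩
  rw [RingHom.comp_apply] at ha
  have h := (IsLocalization.AtPrime.isUnit_to_map_iff L 𝔓 (ψ a)).mp ha
  have hna : a ∉ maximalIdeal R := fun hm => h (by rw [← h𝔓, Ideal.mem_comap] at hm; exact hm)
  exact (IsLocalRing.notMem_maximalIdeal).mp hna

section SmoothCone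

variable {R : Type u} [CommRing R] [IsRegularLocalRing R] (N : MvPolynomial (Fin 3) R) (c : Fin 4 → R)
  (hz : Ideal.span (Set.range c) = maximalIdeal R) (hd : (maximalIdeal R).spanFinrank = 4)

omit [IsRegularLocalRing R] in
/-- The reduced chart polynomial of `N(T₁,T₂,T₃)` on chart `i` is `N̄` with `U_j ↦ killVar_i (j+1)`. [folklore] -/
theorem chartPoly_rename_succ [IsLocalRing R] (i : Fin 4) :
    chartPoly (MvPolynomial.rename Fin.succ N) i =
      MvPolynomial.aeval (fun j : Fin 3 => killVar (R := R) i j.succ) (MvPolynomial.map (residue R) N) := by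
  rw [chartPoly, MvPolynomial.map_rename, MvPolynomial.aeval_rename]
  rfl

omit [IsRegularLocalRing R] in
/-- `∂F_i/∂T₀ = 0` for the form `N(T₁,T₂,T₃)` on a chart `i ≠ 0` (no `T₀` occurs). [folklore] -/
theorem pderiv_zero_chartPoly_rename_succ [IsLocalRing R] (i : Fin 4) (hi : (0 : Fin 4) ≠ i) :
    MvPolynomial.pderiv (⟨0, hi⟩ : {j : Fin 4 // j ≠ i}) (chartPoly (MvPolynomial.rename Fin.succ N) i) = 0 := by
  classical
  rw [chartPoly_rename_succ]
  induction (MvPolynomial.map (residue R) N) using MvPolynomial.induction_on with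
  | C a => rw [MvPolynomial.algHom_C, MvPolynomial.algebraMap_eq, MvPolynomial.pderiv_C]
  | add p q hp hq => rw [map_add, map_add, hp, hq, add_zero]
  | mul_X p s hp =>
    have hks : MvPolynomial.pderiv (⟨0, hi⟩ : {j : Fin 4 // j ≠ i}) (killVar (R := R) i s.succ) = 0 := by
      unfold killVar
      split_ifs with h
      · exact Derivation.map_one_eq_zero _
      · exact MvPolynomial.pderiv_X_of_ne (fun h' => Fin.succ_ne_zero s (congrArg Subtype.val h'))
    rw [map_mul, MvPolynomial.aeval_X, Derivation.leibniz, hp, smul_zero, add_zero, hks, smul_zero]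

variable (𝔓₀ : Ideal (chartRing c 0)) [𝔓₀.IsPrime] (h𝔓₀ : 𝔓₀.comap (chartBase c 0) = maximalIdeal R)
  (L₀ : Type u) [CommRing L₀] [IsLocalRing L₀] [Algebra (chartRing c 0) L₀] [IsLocalization.AtPrime L₀ 𝔓₀]

include hz hd h𝔓₀ in
/-- **Chart `0` (the chart of the carrier) OFF the vertex**: under (HV), at a prime `𝔓` over `𝔪` not containing all of
`e₁, e₂, e₃` the members of `{φ(c₀), f₀}` lying in `𝔓` are part of one regular system of parameters of `L = (B₀)_𝔓` — if every
`∂F₀/∂T_k` vanished at `𝔓̄` then `(T₁,T₂,T₃)^m ⊆ 𝔓̄`, i.e. `𝔓` would be the vertex. [cite: Matsumura1987, Thm. 14.2, Thm. 30.3] -/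
theorem smoothConeChart_zero
    (hV : ∃ m : ℕ, Ideal.span (Set.range (MvPolynomial.X : {j : Fin 4 // j ≠ (0 : Fin 4)} → _)) ^ m ≤
      Ideal.span (insert (chartPoly (MvPolynomial.rename Fin.succ N) 0)
        (Set.range fun t => MvPolynomial.pderiv t (chartPoly (MvPolynomial.rename Fin.succ N) 0))))
    (hnv : ¬ (chartGen c 0 1 ∈ 𝔓₀ ∧ chartGen c 0 2 ∈ 𝔓₀ ∧ chartGen c 0 3 ∈ 𝔓₀)) :
    ∃ (n : ℕ) (v : Fin n → L₀)
      (ι : {g : chartRing c 0 // g ∈ [chartBase c 0 (c 0), chartForm (MvPolynomial.rename Fin.succ N) c 0] ∧ g ∈ 𝔓₀} → Fin n),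
      IsRsopPart v ∧ Function.Injective ι ∧ ∀ g, v (ι g) = (algebraMap (chartRing c 0) L₀ : chartRing c 0 →+* L₀) g.1 := by
  classical
  haveI : IsNoetherianRing (chartRing c 0) := isNoetherianRing_blowupChart c 0
  set Q := MvPolynomial.rename Fin.succ N with hQ
  by_cases hf : chartForm Q c 0 ∈ 𝔓₀
  · have hci : chartBase c 0 (c 0) ∈ 𝔓₀ := map_centre_mem' c hz (chartBase c 0) 𝔓₀ h𝔓₀ 0
    have hK : Ideal.span {chartBase c 0 (c 0)} ≤ 𝔓₀ := (Ideal.span_singleton_le_iff_mem _).mpr hci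
    haveI := isPrime_map_mk 𝔓₀ _ hK
    set 𝔓bar : Ideal (MvPolynomial {j : Fin 4 // j ≠ (0 : Fin 4)} (ResidueField R)) :=
      (𝔓₀.map (Ideal.Quotient.mk (Ideal.span {chartBase c 0 (c 0)}))).comap (coneε c hz hd 0).toRingHom with h𝔓bar
    haveI : 𝔓bar.IsPrime := Ideal.IsPrime.comap _
    have hmem_bar : ∀ G : MvPolynomial {j : Fin 4 // j ≠ (0 : Fin 4)} (ResidueField R), ∀ g : chartRing c 0,
        coneε c hz hd 0 G = Ideal.Quotient.mk _ g → (G ∈ 𝔓bar ↔ g ∈ 𝔓₀) := by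
      intro G g hG
      rw [h𝔓bar, Ideal.mem_comap, RingEquiv.toRingHom_eq_coe, RingHom.coe_coe, hG, ← Ideal.mem_comap,
        Ideal.comap_map_of_surjective _ Ideal.Quotient.mk_surjective, ← RingHom.ker_eq_comap_bot, Ideal.mk_ker,
        sup_eq_left.mpr hK]
    have hFmem : chartPoly Q 0 ∈ 𝔓bar := (hmem_bar _ _ (coneε_chartPoly Q c hz hd 0)).mpr hf
    -- some partial derivative escapes `𝔓̄`, else `𝔓` is the vertex
    obtain ⟨t, ht⟩ : ∃ t, MvPolynomial.pderiv t (chartPoly Q 0) ∉ 𝔓bar := by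
      by_contra h
      simp only [not_exists, not_not] at h
      obtain ⟨m, hm⟩ := hV
      have hle : Ideal.span (Set.range (MvPolynomial.X : {j : Fin 4 // j ≠ (0 : Fin 4)} → _)) ^ m ≤ 𝔓bar := by
        refine hm.trans ?_
        rw [Ideal.span_le]
        rintro G (rfl | ⟨t, rfl⟩)
        · exact hFmem
        · exact h t
      have hX : ∀ k : {j : Fin 4 // j ≠ (0 : Fin 4)}, MvPolynomial.X k ∈ 𝔓bar := fun k =>
        Ideal.IsPrime.le_of_pow_le hle (Ideal.subset_span ⟨k, rfl⟩)
      have he : ∀ k : {j : Fin 4 // j ≠ (0 : Fin 4)}, chartGen c 0 k.1 ∈ 𝔓₀ := fun k =>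
        (hmem_bar _ _ (coneε_X c hz hd 0 k)).mp (hX k)
      exact hnv ⟨he ⟨1, by decide⟩, he ⟨2, by decide⟩, he ⟨3, by decide⟩⟩
    have hF0 : chartPoly Q 0 ≠ 0 := fun h => ht (by rw [h, map_zero]; exact zero_mem _)
    obtain ⟨a₀, ha₀⟩ := Ideal.Quotient.mk_surjective (I := Ideal.span {chartBase c 0 (c 0)})
      (coneε c hz hd 0 (MvPolynomial.pderiv t (chartPoly Q 0)))
    have ha₀P : a₀ ∉ 𝔓₀ := fun h => ht ((hmem_bar _ _ ha₀.symm).mpr h)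
    let σ := {j : {j : Fin 4 // j ≠ (0 : Fin 4)} //
      j ∉ {j : {j : Fin 4 // j ≠ (0 : Fin 4)} | j ∈ ([] : List {j : Fin 4 // j ≠ (0 : Fin 4)})}}
    let emb : {j : Fin 4 // j ≠ (0 : Fin 4)} → σ := fun j => ⟨j, fun h => by simp at h⟩
    have hemb : Function.Injective emb := fun j j' h => by simpa [emb] using congrArg Subtype.val h
    have hval : (Subtype.val ∘ emb) = id := rfl
    let F : MvPolynomial σ (ResidueField R) := MvPolynomial.rename emb (chartPoly Q 0)
    have hvalF : MvPolynomial.rename Subtype.val F = chartPoly Q 0 := by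
      rw [MvPolynomial.rename_rename, hval, MvPolynomial.rename_id, AlgHom.id_apply]
    have hfF : coneε c hz hd 0 (MvPolynomial.rename Subtype.val F) = Ideal.Quotient.mk _ (chartForm Q c 0) := by
      rw [hvalF, coneε_chartPoly]
    have hF0' : F ≠ 0 := fun h => hF0 (MvPolynomial.rename_injective emb hemb (by rw [map_zero]; exact h))
    have hGa : coneε c hz hd 0 (MvPolynomial.rename Subtype.val (MvPolynomial.pderiv (emb t) F)) =
        Ideal.Quotient.mk _ a₀ := by
      rw [MvPolynomial.pderiv_rename hemb, MvPolynomial.rename_rename, hval, MvPolynomial.rename_id, AlgHom.id_apply, ha₀]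
    have hrs : IsRsopPart (consFamily c 0 L₀ (chartBase c 0) (killFamily 0 (chartGen c 0) [] (chartForm Q c 0))) :=
      isRsopPart_kill_hypersurface c 0 hz L₀ (chartBase c 0) (chartGen c 0)
        (reesChartBase_mem_nonZeroDivisors (c 0) (Ideal.mem_span_range_self (f := c) (x := 0)))
        (coneε c hz hd 0) (coneε_X c hz hd 0) 𝔓₀ h𝔓₀ [] List.nodup_nil (by simp) (chartForm Q c 0) hf F hF0' hfF (emb t) a₀
        hGa ha₀P
    exact rsopAdapted_of_consFamily_killFamily c 0 𝔓₀ L₀ [] (chartForm Q c 0) hrs _ (fun g hg _ => by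
      simp only [List.mem_cons, List.not_mem_nil, or_false] at hg
      rcases hg with rfl | rfl
      · exact Or.inl rfl
      · exact Or.inr (Or.inr rfl))
  · have hrs := isRsopPart_chartFamily_cone c hz hd 0 𝔓₀ h𝔓₀ L₀ (a := 0) (fun k => k.elim0)
      (Function.injective_of_subsingleton _) (fun k => k.elim0)
    exact rsopAdapted_of_chartFamily c 0 𝔓₀ L₀ _ hrs _ (fun g hg hgP => by
      simp only [List.mem_cons, List.not_mem_nil, or_false] at hg
      rcases hg with rfl | rfl
      · exact Or.inl rfl
      · exact absurd hgP hf)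

omit [IsRegularLocalRing R] in
/-- **The host at the vertex, one level up**: if `v₁, v₂, v₃` are the images of `e₁, e₂, e₃` in `L`, then the chart form of
`N(T₁,T₂,T₃)` on chart `0` maps to `N^ψ(v₁, v₂, v₃)`, `ψ : R → L` the structure map — the cone over the same curve in the new
regular system of parameters. [folklore] -/
theorem algebraMap_chartForm_rename_succ {L : Type u} [CommRing L] [Algebra (chartRing c 0) L] (v : Fin 4 → L)
    (hv : ∀ k : Fin 3, v k.succ = (algebraMap (chartRing c 0) L : chartRing c 0 →+* L) (chartGen c 0 k.succ)) :
    (algebraMap (chartRing c 0) L : chartRing c 0 →+* L) (chartForm (MvPolynomial.rename Fin.succ N) c 0) =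
      MvPolynomial.eval (fun k : Fin 3 => v k.succ)
        (MvPolynomial.map (((algebraMap (chartRing c 0) L : chartRing c 0 →+* L)).comp (chartBase c 0)) N) := by
  rw [chartForm, MvPolynomial.eval₂Hom_rename, MvPolynomial.map_eval₂Hom, MvPolynomial.eval_map, MvPolynomial.coe_eval₂Hom]
  congr 1
  funext k
  exact (hv k).symm

section ChartNeZero

variable (i : Fin 4) (𝔓 : Ideal (chartRing c i)) [𝔓.IsPrime] (h𝔓 : 𝔓.comap (chartBase c i) = maximalIdeal R)
  (L : Type u) [CommRing L] [IsLocalRing L] [Algebra (chartRing c i) L] [IsLocalization.AtPrime L 𝔓]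

include hz hd h𝔓 in
/-- **Charts `i ≠ 0`**: under (HC) — `(F_i, ∂F_i) = (1)` — at every prime `𝔓` over `𝔪` the members of `{φ(c_i), e₀, f_i}` lying
in `𝔓` (exceptional divisor, strict transform of the old carrier `V(c₀)`, strict transform of the cone) are part of one regular
system of parameters of `L`: some `∂F_i/∂T_j` (`j ≠ 0`, as `F_i` does not involve `T₀`) does not vanish at `𝔓̄`, and the Jacobian
criterion applies with `e₀` killed or not. [cite: Matsumura1987, Thm. 14.2, Thm. 30.3] -/
theorem smoothConeChart_ne_zero (hi0 : i ≠ 0)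
    (hC : Ideal.span (insert (chartPoly (MvPolynomial.rename Fin.succ N) i)
      (Set.range fun t => MvPolynomial.pderiv t (chartPoly (MvPolynomial.rename Fin.succ N) i))) = ⊤) :
    ∃ (n : ℕ) (v : Fin n → L)
      (ι : {g : chartRing c i //
        g ∈ [chartBase c i (c i), chartGen c i 0, chartForm (MvPolynomial.rename Fin.succ N) c i] ∧ g ∈ 𝔓} → Fin n),
      IsRsopPart v ∧ Function.Injective ι ∧ ∀ g, v (ι g) = (algebraMap (chartRing c i) L : chartRing c i →+* L) g.1 := by
  classical
  haveI : IsNoetherianRing (chartRing c i) := isNoetherianRing_blowupChart c i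
  set Q := MvPolynomial.rename Fin.succ N with hQ
  by_cases hf : chartForm Q c i ∈ 𝔓
  · have hci : chartBase c i (c i) ∈ 𝔓 := map_centre_mem' c hz (chartBase c i) 𝔓 h𝔓 i
    have hK : Ideal.span {chartBase c i (c i)} ≤ 𝔓 := (Ideal.span_singleton_le_iff_mem _).mpr hci
    haveI := isPrime_map_mk 𝔓 _ hK
    set 𝔓bar : Ideal (MvPolynomial {j : Fin 4 // j ≠ i} (ResidueField R)) :=
      (𝔓.map (Ideal.Quotient.mk (Ideal.span {chartBase c i (c i)}))).comap (coneε c hz hd i).toRingHom with h𝔓bar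
    have hbar_ne : 𝔓bar ≠ ⊤ := Ideal.comap_ne_top _ (Ideal.IsPrime.ne_top inferInstance)
    have hmem_bar : ∀ G : MvPolynomial {j : Fin 4 // j ≠ i} (ResidueField R), ∀ g : chartRing c i,
        coneε c hz hd i G = Ideal.Quotient.mk _ g → (G ∈ 𝔓bar ↔ g ∈ 𝔓) := by
      intro G g hG
      rw [h𝔓bar, Ideal.mem_comap, RingEquiv.toRingHom_eq_coe, RingHom.coe_coe, hG, ← Ideal.mem_comap,
        Ideal.comap_map_of_surjective _ Ideal.Quotient.mk_surjective, ← RingHom.ker_eq_comap_bot, Ideal.mk_ker,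
        sup_eq_left.mpr hK]
    have hFmem : chartPoly Q i ∈ 𝔓bar := (hmem_bar _ _ (coneε_chartPoly Q c hz hd i)).mpr hf
    obtain ⟨t, ht⟩ : ∃ t, MvPolynomial.pderiv t (chartPoly Q i) ∉ 𝔓bar := by
      by_contra h
      simp only [not_exists, not_not] at h
      refine hbar_ne (eq_top_iff.mpr ?_)
      rw [← hC, Ideal.span_le]
      rintro G (rfl | ⟨t, rfl⟩)
      · exact hFmem
      · exact h t
    have hF0 : chartPoly Q i ≠ 0 := fun h => ht (by rw [h, map_zero]; exact zero_mem _)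
    obtain ⟨a₀, ha₀⟩ := Ideal.Quotient.mk_surjective (I := Ideal.span {chartBase c i (c i)})
      (coneε c hz hd i (MvPolynomial.pderiv t (chartPoly Q i)))
    have ha₀P : a₀ ∉ 𝔓 := fun h => ht ((hmem_bar _ _ ha₀.symm).mpr h)
    -- the kill family for a list `l ⊆ {0}` of killed generators, representative of `f_i` not involving `T₀`
    have key : ∀ (l : List {j : Fin 4 // j ≠ i}), l.Nodup → (∀ j ∈ l, j.1 = 0) → (∀ j ∈ l, chartGen c i j.1 ∈ 𝔓) →
        IsRsopPart (consFamily c i L (chartBase c i) (killFamily i (chartGen c i) l (chartForm Q c i))) := by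
      intro l hl hl0 hlu
      let σ := {j : {j : Fin 4 // j ≠ i} // j ∉ {j : {j : Fin 4 // j ≠ i} | j ∈ l}}
      -- the variables `T_{j+1}` survive the killing
      have hsucc : ∀ (k : Fin 3) (hk : k.succ ≠ i), (⟨k.succ, hk⟩ : {j : Fin 4 // j ≠ i}) ∉
          {j : {j : Fin 4 // j ≠ i} | j ∈ l} := fun k hk hmem => Fin.succ_ne_zero k (hl0 _ hmem)
      let φl : Fin 3 → MvPolynomial σ (ResidueField R) := fun k =>
        if hk : k.succ = i then 1 else MvPolynomial.X ⟨⟨k.succ, hk⟩, hsucc k hk⟩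
      let G : MvPolynomial σ (ResidueField R) := MvPolynomial.aeval φl (MvPolynomial.map (residue R) N)
      have hGval : MvPolynomial.rename Subtype.val G = chartPoly Q i := by
        have hφ : (fun k : Fin 3 => MvPolynomial.rename (Subtype.val : σ → {j : Fin 4 // j ≠ i}) (φl k)) =
            fun k => killVar (R := R) i k.succ := by
          funext k
          simp only [φl, killVar]
          split_ifs with hk
          · rw [map_one]
          · rw [MvPolynomial.rename_X]
        rw [chartPoly_rename_succ, ← hφ, ← MvPolynomial.comp_aeval, AlgHom.comp_apply]
      have hfF : coneε c hz hd i (MvPolynomial.rename Subtype.val G) = Ideal.Quotient.mk _ (chartForm Q c i) := by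
        rw [hGval, coneε_chartPoly]
      have hG0 : G ≠ 0 := fun h => hF0 (by rw [← hGval, h, map_zero])
      -- the escaping partial derivative is in a surviving variable
      have htr : t ∈ Set.range (Subtype.val : σ → {j : Fin 4 // j ≠ i}) := by
        by_contra htn
        apply ht
        rw [← hGval, pderiv_rename_of_not_mem_range htn]
        exact zero_mem _
      obtain ⟨jv, hjv⟩ := htr
      have hGa : coneε c hz hd i (MvPolynomial.rename Subtype.val (MvPolynomial.pderiv jv G)) = Ideal.Quotient.mk _ a₀ := by
        rw [← MvPolynomial.pderiv_rename Subtype.val_injective, hGval, hjv, ha₀]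
      exact isRsopPart_kill_hypersurface c i hz L (chartBase c i) (chartGen c i)
        (reesChartBase_mem_nonZeroDivisors (c i) (Ideal.mem_span_range_self (f := c) (x := i)))
        (coneε c hz hd i) (coneε_X c hz hd i) 𝔓 h𝔓 l hl hlu (chartForm Q c i) hf G hG0 hfF jv a₀ hGa ha₀P
    by_cases h0 : chartGen c i 0 ∈ 𝔓
    · have hrs := key [⟨0, hi0.symm⟩] (List.nodup_singleton _) (by simp) (by simpa using h0)
      exact rsopAdapted_of_consFamily_killFamily c i 𝔓 L _ (chartForm Q c i) hrs _ (fun g hg _ => by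
        simp only [List.mem_cons, List.not_mem_nil, or_false] at hg
        rcases hg with rfl | rfl | rfl
        · exact Or.inl rfl
        · exact Or.inr (Or.inl ⟨⟨0, hi0.symm⟩, List.mem_singleton_self _, rfl⟩)
        · exact Or.inr (Or.inr rfl))
    · have hrs := key [] List.nodup_nil (by simp) (by simp)
      exact rsopAdapted_of_consFamily_killFamily c i 𝔓 L _ (chartForm Q c i) hrs _ (fun g hg hgP => by
        simp only [List.mem_cons, List.not_mem_nil, or_false] at hg
        rcases hg with rfl | rfl | rfl
        · exact Or.inl rfl
        · exact absurd hgP h0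
        · exact Or.inr (Or.inr rfl))
  · by_cases h0 : chartGen c i 0 ∈ 𝔓
    · have hrs := isRsopPart_chartFamily_cone c hz hd i 𝔓 h𝔓 L (a := 1) (fun _ => ⟨0, hi0.symm⟩)
        (Function.injective_of_subsingleton _) (fun _ => h0)
      exact rsopAdapted_of_chartFamily c i 𝔓 L _ hrs _ (fun g hg hgP => by
        simp only [List.mem_cons, List.not_mem_nil, or_false] at hg
        rcases hg with rfl | rfl | rfl
        · exact Or.inl rfl
        · exact Or.inr ⟨0, rfl⟩
        · exact absurd hgP hf)
    · have hrs := isRsopPart_chartFamily_cone c hz hd i 𝔓 h𝔓 L (a := 0) (fun k => k.elim0)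
        (Function.injective_of_subsingleton _) (fun k => k.elim0)
      exact rsopAdapted_of_chartFamily c i 𝔓 L _ hrs _ (fun g hg hgP => by
        simp only [List.mem_cons, List.not_mem_nil, or_false] at hg
        rcases hg with rfl | rfl | rfl
        · exact Or.inl rfl
        · exact absurd hgP h0
        · exact absurd hgP hf)

end ChartNeZero

include hz hd in
/-- On a chart `i ≠ 0`: `f_i ≠ e₀` (as `F_i` does not involve `T₀`, while `∂T₀/∂T₀ = 1`). [folklore] -/
theorem chartForm_rename_succ_ne_chartGen_zero (i : Fin 4) (hi : (0 : Fin 4) ≠ i) :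
    chartForm (MvPolynomial.rename Fin.succ N) c i ≠ chartGen c i 0 := by
  classical
  intro h
  have h1 := coneε_chartPoly (MvPolynomial.rename Fin.succ N) c hz hd i
  rw [h, ← coneε_X c hz hd i ⟨0, hi⟩, (coneε c hz hd i).injective.eq_iff] at h1
  have h2 := congrArg (MvPolynomial.pderiv (⟨0, hi⟩ : {j : Fin 4 // j ≠ i})) h1
  rw [pderiv_zero_chartPoly_rename_succ N i hi, MvPolynomial.pderiv_X_self] at h2
  exact zero_ne_one h2

end SmoothCone

end ConeDepth

end Summit.ResolutionOfSingularities.ResolutionOfSingularities.Theorems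

end
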